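import Literature.AlgebraicGeometry.Motives.GroupSchemeTopFormFrame
import Literature.NumberTheory.EllipticCurves.GenericFibreOpenImmersion
import HarnessLib

/-!
# A smooth model of a group scheme over a dvr carries a rational top form which is a frame at every
# point of the generic fibre

Topic `Literature/AlgebraicGeometry/Motives` (proofs only; no definitions, no named facts).  The
model-side form of ★ `exists_topForm_frame_of_grpObj` (Bosch–Lütkebohmert–Raynaud, *Néron Models*,
§4.2 Prop. 1–2, read on a smooth model `𝒳 → Spec R` of the group scheme `E = 𝒳_K`):

* `stalkHom_mk_comp_specGenericPoint` — the structure maps of the stalks of `E` seen as an `R`-scheme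
  through `Spec K → Spec R`;
* `exists_topForm_frame_genericFibre_of_grpObj` — there is a rational top form `θ = (f₀, y)` over
  `R` on `𝒳` which is a frame at every point over the generic point of `Spec R`, for every system of
  local coordinates over `R` (text of the cell's `stub_L4a'`, with the group scheme `E` and the
  isomorphism `e : 𝒳_K ≅ E` as explicit hypotheses).  Transport along the open immersion
  `E ≅ 𝒳_K ↪ 𝒳`: stalks by ★ `exists_basis_of_bijective_eq_D`, base `R ↔ K = Frac R` by
  ★ `kaehlerDifferentialEquivOfIsLocalization`, determinants by ★ `det_D_ringHom_eq`, units by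
  ★ `RatFn.isUnitAt_iff_of_flat`.

Cell `hodgecm-mathlib`, road W of `r₀` ((W0) leaf L4a'-ASM part (B); input of B-p18's core
`core_fst` / `stub_S5_S9` and of L4c′).

## Sources

* S. Bosch, W. Lütkebohmert, M. Raynaud, *Néron Models*, Ergebnisse (3) 21, Springer 1990, §4.2
  Prop. 1–2, §1.2 (the generic fibre). [BLRNeronModels1990]
* U. Görtz, T. Wedhorn, *Algebraic Geometry I: Schemes*, 2nd ed., Springer Spektrum 2020, (3.4)–(3.5).
  [GortzWedhorn2020]
-/

noncomputable section

universe u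

namespace Literature.AlgebraicGeometry.Motives

open CategoryTheory Limits _root_.AlgebraicGeometry MonoidalCategory CartesianMonoidalCategory
open RatFn Literature.AlgebraicGeometry.Smoothening
open scoped MonObj CategoryTheory.Obj

/-! ### Transport to a smooth model over a discrete valuation ring -/

section Model

open Literature.NumberTheory.EllipticCurves Literature.RingTheory.Localization

variable (R : Type u) [CommRing R] [IsDomain R] [IsDiscreteValuationRing R]
  (K : Type u) [Field K] [Algebra R K] [IsFractionRing R K]
  (𝒳 : Over (Spec (.of R))) (n : ℕ) [SmoothOfRelativeDimension n 𝒳.hom] [IsIntegral 𝒳.left]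
  [IsIntegral (𝒳 ⊗ 𝒳).left] (E : Over (Spec (.of K)))

omit [IsDomain R] [IsDiscreteValuationRing R] [IsFractionRing R K] [SmoothOfRelativeDimension n 𝒳.hom]
  [IsIntegral 𝒳.left] [IsIntegral (𝒳 ⊗ 𝒳).left] in
/-- The structure map of the stalks of `E` seen as an `R`-scheme through `Spec K → Spec R` is
`stalkHom E x ∘ (R → K)` (Görtz–Wedhorn I, (3.4)–(3.5)). [cite: GortzWedhorn2020, (3.4)–(3.5)] -/
theorem stalkHom_mk_comp_specGenericPoint (x : E.left) :
    stalkHom (Over.mk (E.hom ≫ specGenericPoint R K) : Over (Spec (.of R))) x =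
      (stalkHom E x).comp (algebraMap R K) := by
  ext r
  have h := Scheme.ΓSpecIso_inv_naturality (CommRingCat.ofHom (algebraMap R K))
  have h' : (Spec.map (CommRingCat.ofHom (algebraMap R K))).appTop.hom
      ((Scheme.ΓSpecIso (.of R)).inv.hom r) =
      (Scheme.ΓSpecIso (.of K)).inv.hom (algebraMap R K r) := by
    have := congrArg (fun φ => φ.hom r) h
    simpa only [CommRingCat.hom_comp, RingHom.coe_comp, Function.comp_apply,
      CommRingCat.hom_ofHom] using this.symm
  change (E.left.presheaf.germ ⊤ x trivial).hom
      ((E.hom ≫ specGenericPoint R K).appTop.hom ((Scheme.ΓSpecIso (.of R)).inv.hom r)) =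
    (E.left.presheaf.germ ⊤ x trivial).hom
      (E.hom.appTop.hom ((Scheme.ΓSpecIso (.of K)).inv.hom (algebraMap R K r)))
  rw [Scheme.Hom.comp_appTop, CommRingCat.hom_comp, RingHom.comp_apply, h']

/-- **A smooth model of a group scheme over a dvr carries a rational top form which is a frame at
every point of the generic fibre** — the model-side form of `exists_topForm_frame_of_grpObj`
(text of B-p18's `stub_L4a'`): for `𝒳 → Spec R` smooth of relative dimension `n` (`R` a dvr with
fraction field `K`, `𝒳` and `𝒳 ×_R 𝒳` integral) whose generic fibre is a group scheme `E`, there is a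
rational top form `θ = (f₀, y)` over `R` on `𝒳` (`d yᵢ` a basis `B₀` of `Ω[K(𝒳)⁄R]`) which is a frame
at every point `p` over the generic point of `Spec R`, for every system of local coordinates `z` at
`p` over `R` (`𝒪_{𝒳,p}` an `R`-algebra through ★ `stalkHom`). Transport of the `E`-side theorem along
the open immersion `E ≅ 𝒳_K ↪ 𝒳` (★ `exists_iso_pullback_specGenericPoint_opens` currency): stalks
by ★ `exists_basis_of_bijective_eq_D`, the base `R ↔ K` by ★ `kaehlerDifferentialEquivOfIsLocalization`,
determinants by ★ `det_D_ringHom_eq`, units by ★ `RatFn.isUnitAt_iff_of_flat`.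
[cite: BLRNeronModels1990, §4.2 Prop. 1–2] -/
theorem exists_topForm_frame_genericFibre_of_grpObj [GrpObj E] (e : (genericFibre R K).obj 𝒳 ≅ E)
    [Algebra R 𝒳.left.functionField]
    (hRL : algebraMap R 𝒳.left.functionField = stalkHom 𝒳 (genericPoint 𝒳.left)) :
    ∃ (f₀ : 𝒳.left.functionField) (y : Fin n → 𝒳.left.functionField)
      (B₀ : Module.Basis (Fin n) 𝒳.left.functionField Ω[𝒳.left.functionField⁄R]),
      (∀ i, B₀ i = KaehlerDifferential.D R _ (y i)) ∧
      ∀ (p : 𝒳.left) (_ : 𝒳.hom.base p ∈ Set.range (specGenericPoint R K).base)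
        (z : Fin n → 𝒳.left.presheaf.stalk p)
        (b : letI := (stalkHom 𝒳 p).toAlgebra
          Module.Basis (Fin n) (𝒳.left.presheaf.stalk p) Ω[𝒳.left.presheaf.stalk p⁄R])
        (_ : letI := (stalkHom 𝒳 p).toAlgebra; ∀ i, b i = KaehlerDifferential.D R _ (z i))
        (B : Module.Basis (Fin n) 𝒳.left.functionField Ω[𝒳.left.functionField⁄R])
        (_ : ∀ i, B i = KaehlerDifferential.D R _ (toFunctionField p (z i))),
        IsUnitAt p (f₀ * B.det B₀) := by
  classical
  haveI : IsOpenImmersion (specGenericPoint R K) := isOpenImmersion_specGenericPoint R K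
  -- ### the open immersion `j : E ≅ 𝒳_K ↪ 𝒳`, and `E` as an `R`-scheme `𝒴`
  let jK : ((genericFibre R K).obj 𝒳).left ⟶ 𝒳.left := pullback.fst 𝒳.hom (specGenericPoint R K)
  have hjK : jK ≫ 𝒳.hom = ((genericFibre R K).obj 𝒳).hom ≫ specGenericPoint R K := pullback.condition
  haveI : IsOpenImmersion jK :=
    inferInstanceAs (IsOpenImmersion (pullback.fst 𝒳.hom (specGenericPoint R K)))
  haveI : IsIso e.inv.left := by
    change IsIso ((Over.forget _).map e.inv)
    infer_instance
  let j : E.left ⟶ 𝒳.left := e.inv.left ≫ jK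
  have hj : j ≫ 𝒳.hom = E.hom ≫ specGenericPoint R K := by
    change (e.inv.left ≫ jK) ≫ 𝒳.hom = _
    rw [Category.assoc, hjK, ← Category.assoc, Over.w e.inv]
  haveI : IsOpenImmersion j := inferInstance
  let 𝒴 : Over (Spec (.of R)) := Over.mk (E.hom ≫ specGenericPoint R K)
  let f : 𝒴 ⟶ 𝒳 := Over.homMk j hj
  -- ### `E` is non-empty and integral, `E × E` is integral, the projections are dominant, `E` is smooth
  haveI : Subsingleton ↥(Spec (CommRingCat.of K)) := inferInstanceAs (Subsingleton (PrimeSpectrum K))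
  haveI : Nonempty ↥(Spec (CommRingCat.of K)) := inferInstanceAs (Nonempty (PrimeSpectrum K))
  haveI hEne : Nonempty E.left :=
    ⟨η[E].left (show ↥(𝟙_ (Over (Spec (CommRingCat.of K)))).left from
      Classical.arbitrary ↥(Spec (CommRingCat.of K)))⟩
  haveI : IsIntegral E.left := isIntegral_of_isOpenImmersion j
  have hjrange : Set.range j = {x | 𝒳.hom x ∈ Set.range (specGenericPoint R K)} := by
    have hsurj : Function.Surjective e.inv.left :=
      (Scheme.homeoOfIso ((Over.forget _).mapIso e).symm).surjective
    change Set.range (e.inv.left ≫ jK) = _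
    rw [Scheme.Hom.comp_base, TopCat.coe_comp, hsurj.range_comp]
    exact Scheme.Pullback.range_fst 𝒳.hom (specGenericPoint R K)
  haveI : IsDominant j := by
    refine ⟨?_⟩
    change Dense (Set.range j)
    exact j.isOpenEmbedding.isOpen_range.dense ⟨j (Classical.arbitrary _), ⟨_, rfl⟩⟩
  haveI : Surjective E.hom := inferInstance
  haveI hd₁ : IsDominant (fst E E).left := by
    have : Surjective (pullback.fst E.hom E.hom) := MorphismProperty.pullback_fst _ _ inferInstance
    exact (inferInstance : IsDominant (pullback.fst E.hom E.hom))
  haveI hd₂ : IsDominant (snd E E).left := by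
    have : Surjective (pullback.snd E.hom E.hom) := MorphismProperty.pullback_snd _ _ inferInstance
    exact (inferInstance : IsDominant (pullback.snd E.hom E.hom))
  haveI : SmoothOfRelativeDimension n E.hom := by
    haveI := smoothOfRelativeDimension_isStableUnderBaseChange (n := n)
    have h1 : SmoothOfRelativeDimension n ((genericFibre R K).obj 𝒳).hom :=
      MorphismProperty.pullback_snd (P := @SmoothOfRelativeDimension n) 𝒳.hom
        (specGenericPoint R K) inferInstance
    have h2 : E.hom = e.inv.left ≫ ((genericFibre R K).obj 𝒳).hom := (Over.w e.inv).symm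
    rw [h2]
    exact (MorphismProperty.cancel_left_of_respectsIso
      (@SmoothOfRelativeDimension n) e.inv.left _).mpr h1
  haveI : IsIntegral (E ⊗ E).left := by
    let jj : pullback E.hom E.hom ⟶ pullback 𝒳.hom 𝒳.hom :=
      pullback.map E.hom E.hom 𝒳.hom 𝒳.hom j j (specGenericPoint R K) hj.symm hj.symm
    haveI : IsOpenImmersion jj :=
      Scheme.pullback_map_isOpenImmersion _ _ _ _ _ _ _ _ _
    haveI : Nonempty ↥(pullback E.hom E.hom) :=
      ⟨(lift (𝟙 E) (𝟙 E)).left (Classical.arbitrary E.left)⟩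
    haveI : IsIntegral (pullback 𝒳.hom 𝒳.hom) := (inferInstance : IsIntegral (𝒳 ⊗ 𝒳).left)
    have hint : IsIntegral (pullback E.hom E.hom) := isIntegral_of_isOpenImmersion jj
    exact hint
  -- ### the `E`-side theorem
  letI algKE : Algebra K E.left.functionField := (stalkHom E (genericPoint E.left)).toAlgebra
  obtain ⟨f₀E, yE, B₀E, hB₀E, frameE⟩ := exists_topForm_frame_of_grpObj E n rfl
  -- ### `σ : K(𝒳) ≃ K(E)` and the `R`-structures
  haveI : IsIntegral 𝒴.left := ‹IsIntegral E.left›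
  haveI : IsDominant f.left := ‹IsDominant j›
  let σ := functionFieldEquiv j
  have hσ : ∀ x, σ x = functionFieldMap j x := fun x => rfl
  have hσR : (functionFieldMap j).comp (stalkHom 𝒳 (genericPoint 𝒳.left)) =
      (stalkHom E (genericPoint E.left)).comp (algebraMap R K) := by
    rw [← stalkHom_mk_comp_specGenericPoint R K E]
    exact functionFieldMap_comp_stalkHom f
  letI algRE : Algebra R E.left.functionField :=
    ((stalkHom E (genericPoint E.left)).comp (algebraMap R K)).toAlgebra
  haveI : IsScalarTower R K E.left.functionField := IsScalarTower.of_algebraMap_eq' rfl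
  have hστ : (functionFieldMap j).comp (algebraMap R 𝒳.left.functionField) =
      (algebraMap K E.left.functionField).comp (algebraMap R K) := by
    rw [hRL]; exact hσR
  -- ### the top form on `𝒳`: `y := σ⁻¹ yE`, `f₀ := σ⁻¹ f₀E`, `B₀` transported
  let eL := kaehlerDifferentialEquivOfIsLocalization R K E.left.functionField (nonZeroDivisors R)
  let B₀E' : Module.Basis (Fin n) E.left.functionField Ω[E.left.functionField⁄R] := B₀E.map eL.symm
  have hB₀E' : ∀ i, B₀E' i = KaehlerDifferential.D R _ (yE i) := fun i => by
    rw [Module.Basis.map_apply, hB₀E i, LinearEquiv.symm_apply_eq,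
      kaehlerDifferentialEquivOfIsLocalization_D]
  have hσsymm : σ.symm.toRingHom.comp (algebraMap R E.left.functionField) =
      algebraMap R 𝒳.left.functionField := by
    ext r
    change σ.symm ((stalkHom E (genericPoint E.left)).comp (algebraMap R K) r) = _
    rw [← hσR, RingHom.comp_apply, ← hσ, RingEquiv.symm_apply_apply, hRL]
  obtain ⟨B₀, hB₀⟩ := exists_basis_of_bijective_eq_D σ.symm.toRingHom σ.symm.bijective hσsymm
    B₀E' hB₀E'
  refine ⟨σ.symm f₀E, fun i => σ.symm (yE i), B₀, hB₀, ?_⟩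
  -- ### the frame condition at a point `p = j p'` of the generic fibre
  intro p hp z b hb B hB
  have hp' : p ∈ Set.range j := by rw [hjrange]; exact hp
  obtain ⟨p', rfl⟩ := hp'
  letI algR𝒳 : Algebra R (𝒳.left.presheaf.stalk (j p')) := (stalkHom 𝒳 (j p')).toAlgebra
  letI algKO : Algebra K (E.left.presheaf.stalk p') := (stalkHom E p').toAlgebra
  letI algRO : Algebra R (E.left.presheaf.stalk p') :=
    ((stalkHom E p').comp (algebraMap R K)).toAlgebra
  haveI : IsScalarTower R K (E.left.presheaf.stalk p') := IsScalarTower.of_algebraMap_eq' rfl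
  haveI : IsScalarTower K (E.left.presheaf.stalk p') E.left.functionField :=
    IsScalarTower.of_algebraMap_eq' (toFunctionField_comp_stalkHom E p').symm
  -- transport of the coordinates `z` along `j♯_{p'} : 𝒪_{𝒳, j p'} ≅ 𝒪_{E, p'}`
  have hφR : (j.stalkMap p').hom.comp (algebraMap R (𝒳.left.presheaf.stalk (j p'))) =
      algebraMap R (E.left.presheaf.stalk p') := by
    change (f.left.stalkMap p').hom.comp (stalkHom 𝒳 (f.left p')) =
      (stalkHom E p').comp (algebraMap R K)
    rw [← stalkHom_mk_comp_specGenericPoint R K E]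
    exact stalkMap_comp_stalkHom f p'
  obtain ⟨b', hb'⟩ := exists_basis_of_bijective_eq_D (j.stalkMap p').hom
    (ConcreteCategory.bijective_of_isIso (j.stalkMap p')) hφR b hb
  let eO := kaehlerDifferentialEquivOfIsLocalization R K (E.left.presheaf.stalk p') (nonZeroDivisors R)
  let b'' : Module.Basis (Fin n) (E.left.presheaf.stalk p') Ω[E.left.presheaf.stalk p'⁄K] := b'.map eO
  have hb'' : ∀ i, b'' i = KaehlerDifferential.D K _ (j.stalkMap p' (z i)) := fun i => by
    rw [Module.Basis.map_apply, hb' i, kaehlerDifferentialEquivOfIsLocalization_D]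
  obtain ⟨B'', hB''⟩ := exists_basis_functionField_of_localCoordinates' n K b'' hb''
  -- the `E`-side frame at `p'`
  have hfrE := frameE p' (fun i => j.stalkMap p' (z i)) b'' hb'' B'' hB''
  -- read the frame condition on `𝒳` through `σ`
  rw [isUnitAt_iff_of_flat j p']
  have hB''σ : ∀ i, B'' i = KaehlerDifferential.D K _
      (functionFieldMap j (toFunctionField (j p') (z i))) := fun i => by
    rw [hB'' i, functionFieldMap_toFunctionField j p' (z i)]
  have hdet := det_D_ringHom_eq (algebraMap R K) (functionFieldMap j) hστ B hB B'' hB''σ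
    (fun i => σ.symm (yE i))
  have hy : (fun k => KaehlerDifferential.D K E.left.functionField
      (functionFieldMap j (σ.symm (yE k)))) = ⇑B₀E := funext fun k => by
    rw [← hσ, RingEquiv.apply_symm_apply, hB₀E k]
  have hy' : (fun k => KaehlerDifferential.D R 𝒳.left.functionField (σ.symm (yE k))) = ⇑B₀ :=
    funext fun k => (hB₀ k).symm
  rw [hy, hy'] at hdet
  have hf₀ : functionFieldMap j (σ.symm f₀E) = f₀E := by rw [← hσ, RingEquiv.apply_symm_apply]
  rw [map_mul, hf₀, ← hdet]
  exact hfrE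

end Model

end Literature.AlgebraicGeometry.Motives

end
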